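import Literature.NumberTheory.Automorphic.LocalUnitaryGroupCongr
import Literature.NumberTheory.Automorphic.UnitaryGroupInertPlaceHyperbolicBasisDyadic
import Literature.NumberTheory.Automorphic.UnitaryGroupWeylInversion
import HarnessLib

/-!
# The local integral level `U(J)(𝒪_v) ≤ U(J)(F_v)` on the carrier `UnitaryGroup.«local»`, and LEVEL MATCHING: for
# almost every `v` the local isomorphism `ψ_v : U(J)(F_v) ≃ₜ* U(Φ_N)(F_v)` carries `U(J)(𝒪_v)` onto `U(Φ_N)(𝒪_v)`
(Rogawski, *Automorphic representations of unitary groups in three variables* (1990), §14.2 p. 233; Platonov–Rapinchuk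
(1994), §5.1; Tits, *Reductive groups over local fields* (1979), §3.8; Jacobowitz (1962), §7 Thm. 7.1)

Topic `NumberTheory/Automorphic`; namespace `Literature.NumberTheory.Automorphic.UnitaryGroup`.  ONE real definition
(`localIntegralLevel`, + its CM dress `cmLocalIntegralLevel`) and proved theorems; **no named fact, no `sorry`, no
instance, no notation**.

**Setting** — that of `UnitaryGroupLocalFactors` ∕ `LocalUnitaryGroupCongr`: `E/F` number fields, `c : E ≃ₐ[F] E`, `N : ℕ`,
`J ∈ M_N(E)`, a finite place `v` of `F`, `E_v = E ⊗_F F_v = Π_{w ∣ v} E_w` (`UnitaryGroup.LocalRing E v`) and the local group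
`U(J)(F_v) = UnitaryGroup.«local» E c N J v ≤ GL_N(E_v)` — the carrier of `(UnitaryGroup.cmDatum L N H).Local v` in the CM
case (★ `cmDatum_Local`, `rfl`).  The tree's ★ `UnitaryGroup.localInt E c N J v ≤ localPi E c N J v` is the stabiliser
`U(J)(𝒪_v) = U(J)(F_v) ∩ Π_{w ∣ v} GL_N(𝒪_w)` of the standard lattice `Π_{w ∣ v} 𝒪_w^N = 𝓞_E^N ⊗_{𝓞_F} 𝒪_v` on the
FACTOR carrier `localPi ≤ Π_{w ∣ v} GL_N(E_w)` ([PlatonovRapinchuk1994, §5.1] `G_{𝒪_v}`; [Tits1979, §3.8]: hyperspecial when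
`J_w ∈ GL_N(𝒪_w)` and `v` is unramified); this file moves it to `«local»` and proves that the quasi-split comparison
`U(J)(F_v) ≃ U(Φ_N)(F_v)` of `LocalUnitaryGroupCongr` ∕ `LocalHermitianFormsRankThree` can be chosen LEVEL-PRESERVING off a
finite set of places — the content of [Rogawski1990, §14.2 p. 233]: «for `v ∉ S₀ ∪ S` … `K_v ≃ K′_v` and `f_v = f′_v`» (the
identification of the hyperspecial levels through `ψ_v` that makes the unramified local transfer the identity; the
tree's ★ `LocalTransferAway` of `Rogawski1990/TestFunctions` is phrased with indicator factors of such levels).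

* §1 `localIntegralLevel c N J v : Subgroup («local» E c N J v)` := `localInt` pulled back along ★ `localPiEquiv`
  (`g ∈ U(J)(𝒪_v) ↔ ∀ w ∣ v, g_w ∈ GL_N(𝒪_w)`, `mem_localIntegralLevel_iff`), COMPACT and OPEN
  (`isCompact_localIntegralLevel`, `isOpen_localIntegralLevel`, from ★ `isCompact_localInt` ∕ `isOpen_localInt`).
* §2 the UNRAMIFIED DATUM at almost every place: for `J ∈ GL_N(E)`, `∀ᶠ v, ∀ w ∣ v, J_w ∈ GL_N(𝒪_w)`
  (`eventually_forall_unit_placeForm_mem_glInt`, ★ `eventually_forall_map_mem_glInt`); only finitely many `v` ramify in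
  `E` (`finite_setOf_not_isUnramifiedIn`, the different).
* §3 NON-SPLIT level matching (`E/F` quadratic, `c ≠ 1`, `w ∣ v` with `c • w = w`): membership read in the one-place model
  (`mem_localIntegralLevel_iff_of_smul_eq`: `g ∈ U(J)(𝒪_v) ↔ g_w ∈ GL_N(𝒪_w)` via ★ `localNonsplitEquiv`), and at an
  UNRAMIFIED `v` with `J_w ∈ GL_N(𝒪_w)` the integral hyperbolic basis `T ∈ GL_N(𝒪_w)`, `J_w = ᵗσ_w(T) · Φ_N · T` (★
  `exists_glInt_placeForm_eq_formCongr_antidiagonal_of_isUnramifiedIn`, [Jacobowitz1962, §7 Thm. 7.1], dyadic places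
  included) conjugates `U(J)(F_v)` onto `U(Φ_N)(F_v)` (★ `localNonsplitCongr`) MATCHING THE LEVELS
  (`exists_continuousMulEquiv_localIntegralLevel_iff_of_smul_eq`).
* §4 SPLIT level matching (`c • w ≠ w`, `J_w ∈ GL_N(𝒪_w)`): `g ∈ U(J)(𝒪_v) ↔ g_w ∈ GL_N(𝒪_w)` through ★ `localSplitEquiv`
  (`mem_localIntegralLevel_iff_of_ne`, from ★ `localPiSplitEquiv_symm_mem_localInt_iff`), so ★ `localSplitCongr` matches the
  levels (`exists_continuousMulEquiv_localIntegralLevel_iff_of_ne`; `Φ_N` is hyperspecial everywhere, ★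
  `StdForm.unit_over_mem_glInt`).
* §5 **a.e. level matching** `eventually_exists_continuousMulEquiv_localIntegralLevel_iff`: for `c ≠ 1`, `J` `c`-hermitian with
  `det J` a unit, `∀ᶠ v in cofinite, ∃ ψ : U(J)(F_v) ≃ₜ* U(Φ_N)(F_v), ∀ g, ψ g ∈ U(Φ_N)(𝒪_v) ↔ g ∈ U(J)(𝒪_v)` (the
  exceptional set: `v` ramified in `E`, or `J_w ∉ GL_N(𝒪_w)` for some `w ∣ v`), with the `Subgroup.comap` form; §6 the CM
  dress on `(cmDatum L N H).Local v` (`cmLocalIntegralLevel`, hermitian-invertible and anisotropic variants).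

`Φ_N` is the literal `Matrix.of fun i j : Fin N => if i.val + j.val + 1 = N then 1 else 0` of the consumers (★
`antidiagOne_eq_over`: `= (StdForm.antidiagonal N).over`).  Written for the cell `hodgecm-mathlib` (ENGINE T1, line
`F0_T1InnerFormTraceIdentity`, brick B9: the `v ∉ S₀` layer of [Rogawski1990, §14.2]).  HC_CM is proved only modulo the
printed citations until rung 0 closes; this file is unconditional.

## References
* [Rogawski1990] J. Rogawski, Ann. of Math. Stud. 123 (1990), §14.2 p. 233.
* [PlatonovRapinchuk1994] V. Platonov, A. Rapinchuk, *Algebraic Groups and Number Theory* (1994), §5.1 (`G_{𝒪_v}`; `G_{𝒪_v}`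
  for almost all `v` under a change of realisation).
* [Tits1979] J. Tits, *Reductive groups over local fields*, PSPM 33.1 (1979), §3.8 (hyperspecial subgroups).
* [Jacobowitz1962] R. Jacobowitz, *Hermitian forms over local fields*, Amer. J. Math. 84 (1962), §7 Thm. 7.1.
-/

set_option autoImplicit false

noncomputable section

open NumberField IsDedekindDomain Filter
open scoped Matrix

namespace Literature.NumberTheory.Automorphic.UnitaryGroup

section Generic

variable {F E : Type} [Field F] [NumberField F] [Field E] [NumberField E] [Algebra F E]
  (c : E ≃ₐ[F] E) (N : ℕ) (J : Matrix (Fin N) (Fin N) E)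

/-! ## §1 The local integral level `U(J)(𝒪_v) ≤ U(J)(F_v)` on the carrier `«local»` -/

/-- **The local integral level `U(J)(𝒪_v) ≤ U(J)(F_v)`** on the matrix carrier `«local» E c N J v ≤ GL_N(E ⊗_F F_v)`: the
stabiliser of the standard lattice `Π_{w ∣ v} 𝒪_w^N = 𝓞_E^N ⊗ 𝒪_v`, i.e. the tree's `localInt` (on the factor carrier
`localPi ≤ Π_{w ∣ v} GL_N(E_w)`) pulled back along `localPiEquiv`.  In the CM case this is a subgroup of
`(cmDatum L N H).Local v` (`cmLocalIntegralLevel`). [cite: PlatonovRapinchuk1994, §5.1] -/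
def localIntegralLevel (v : HeightOneSpectrum (𝓞 F)) : Subgroup («local» E c N J v) :=
  (localInt E c N J v).comap (localPiEquiv E c N J v).symm.toMulEquiv.toMonoidHom

/-- `(localPiEquiv).symm g ∈ U(J)(𝒪_v)` (factor carrier) iff `g ∈ U(J)(𝒪_v)` (matrix carrier) — definitional.
[cite: PlatonovRapinchuk1994, §5.1] -/
theorem localPiEquiv_symm_mem_localInt_iff (v : HeightOneSpectrum (𝓞 F)) (g : «local» E c N J v) :
    (localPiEquiv E c N J v).symm g ∈ localInt E c N J v ↔ g ∈ localIntegralLevel c N J v :=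
  Iff.rfl

/-- `localPiEquiv u ∈ U(J)(𝒪_v)` (matrix carrier) iff `u ∈ U(J)(𝒪_v)` (factor carrier). [cite: PlatonovRapinchuk1994, §5.1] -/
theorem localPiEquiv_mem_localIntegralLevel_iff (v : HeightOneSpectrum (𝓞 F)) (u : localPi E c N J v) :
    localPiEquiv E c N J v u ∈ localIntegralLevel c N J v ↔ u ∈ localInt E c N J v := by
  rw [← localPiEquiv_symm_mem_localInt_iff, ContinuousMulEquiv.symm_apply_apply]

/-- **Membership**: `g ∈ U(J)(𝒪_v) ↔ ∀ w ∣ v, g_w ∈ GL_N(𝒪_w)` (the `w`-components of `g ∈ GL_N(Π_{w∣v} E_w)`).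
[cite: PlatonovRapinchuk1994, §5.1] -/
theorem mem_localIntegralLevel_iff (v : HeightOneSpectrum (𝓞 F)) (g : «local» E c N J v) :
    g ∈ localIntegralLevel c N J v ↔
      ∀ w : PlacesOver E v, localGLPiEquiv E N v (g : GL (Fin N) (LocalRing E v)) w ∈ glInt N (w.1.adicCompletion E) := by
  rw [← localPiEquiv_symm_mem_localInt_iff, mem_localInt_iff]
  rfl

/-- As a set, `U(J)(𝒪_v)` on `«local»` is the image of `localInt` under `localPiEquiv`. [cite: PlatonovRapinchuk1994, §5.1] -/
theorem coe_localIntegralLevel (v : HeightOneSpectrum (𝓞 F)) :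
    (localIntegralLevel c N J v : Set («local» E c N J v)) =
      localPiEquiv E c N J v '' (localInt E c N J v : Set (localPi E c N J v)) := by
  ext g
  constructor
  · intro hg
    exact ⟨(localPiEquiv E c N J v).symm g, hg, (localPiEquiv E c N J v).apply_symm_apply g⟩
  · rintro ⟨u, hu, rfl⟩
    exact (localPiEquiv_mem_localIntegralLevel_iff c N J v u).2 hu

/-- **`U(J)(𝒪_v)` is open in `U(J)(F_v)`.** [cite: PlatonovRapinchuk1994, §5.1] -/
theorem isOpen_localIntegralLevel (v : HeightOneSpectrum (𝓞 F)) :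
    IsOpen (localIntegralLevel c N J v : Set («local» E c N J v)) :=
  (isOpen_localInt E c N J v).preimage (localPiEquiv E c N J v).symm.continuous

/-- **`U(J)(𝒪_v)` is compact.** [cite: PlatonovRapinchuk1994, §5.1] -/
theorem isCompact_localIntegralLevel (v : HeightOneSpectrum (𝓞 F)) :
    IsCompact (localIntegralLevel c N J v : Set («local» E c N J v)) := by
  rw [coe_localIntegralLevel]
  exact (isCompact_localInt E c N J v).image (localPiEquiv E c N J v).continuous

/-! ## §2 The unramified datum at almost every place -/

omit [NumberField F] in
/-- **`J_w ∈ GL_N(𝒪_w)` at almost every place** (regrouped over the places of `F`): for `J ∈ GL_N(E)`,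
`∀ᶠ v, ∀ w ∣ v`, the unit `J_w = placeForm J w` of `M_N(E_w)` lies in `GL_N(𝒪_w)` («`J` and `J⁻¹` are `v`-integral for almost all
`v`»). [cite: PlatonovRapinchuk1994, §5.1] -/
theorem eventually_forall_unit_placeForm_mem_glInt (hJ : IsUnit J) :
    ∀ᶠ v : HeightOneSpectrum (𝓞 F) in cofinite, ∀ w : PlacesOver E v,
      (isUnit_placeForm J hJ w.1).unit ∈ glInt N (w.1.adicCompletion E) := by
  filter_upwards [eventually_forall_map_mem_glInt F E hJ.unit] with v hv w
  have h : (isUnit_placeForm J hJ w.1).unit =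
      Matrix.GeneralLinearGroup.map (algebraMap E (w.1.adicCompletion E)) hJ.unit :=
    Units.ext (by
      rw [IsUnit.unit_spec]
      change placeForm J w.1 = (hJ.unit : Matrix (Fin N) (Fin N) E).map (algebraMap E (w.1.adicCompletion E))
      rw [IsUnit.unit_spec])
  rw [h]
  exact hv w

/-- **Only finitely many places of `F` ramify in `E`**: they lie below the prime factors of the different `𝔇_{E/F} ≠ 0`
(Mathlib `dvd_differentIdeal_iff`, `Ideal.finite_factors`; as in the tree's `FrobeniusDensityTheorem`, reproved to keep the
imports local). [folklore] -/
private theorem finite_setOf_not_isUnramifiedIn :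
    {v : HeightOneSpectrum (𝓞 F) | ¬ Algebra.IsUnramifiedIn (𝓞 E) v.asIdeal}.Finite := by
  have hD : differentIdeal (𝓞 F) (𝓞 E) ≠ ⊥ := differentIdeal_ne_bot
  have hfin : {Q : HeightOneSpectrum (𝓞 E) | Q.asIdeal ∣ differentIdeal (𝓞 F) (𝓞 E)}.Finite :=
    Ideal.finite_factors hD
  refine (hfin.image fun Q => Q.under (𝓞 F)).subset ?_
  intro q hq
  simp only [Set.mem_setOf_eq, Algebra.IsUnramifiedIn, not_forall] at hq
  obtain ⟨Q, hQprime, hQover, hQunr⟩ := hq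
  haveI := hQprime
  have hQne : Q ≠ ⊥ := Ideal.ne_bot_of_liesOver_of_ne_bot q.ne_bot Q
  refine ⟨⟨Q, hQprime, hQne⟩, ?_, ?_⟩
  · exact dvd_differentIdeal_iff.mpr hQunr
  · exact HeightOneSpectrum.ext hQover.over.symm

/-! ## §3 Non-split places: membership in the one-place model; level matching by an integral hyperbolic basis -/

section Nonsplit

variable [Algebra.IsQuadraticExtension F E] {v : HeightOneSpectrum (𝓞 F)}

/-- At a non-split place (`c • w = w`, `w` the only place above `v`): `g ∈ U(J)(𝒪_v) ↔ g_w ∈ GL_N(𝒪_w)`, `g_w` the image of `g`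
in the one-place model `U(σ_w, J_w)(E_w)` (★ `localNonsplitEquiv`). [cite: PlatonovRapinchuk1994, §5.1] -/
theorem mem_localIntegralLevel_iff_of_smul_eq (hc : c ≠ 1) (w : PlacesOver E v) (hw : c • w.1 = w.1)
    (g : «local» E c N J v) :
    g ∈ localIntegralLevel c N J v ↔
      ((localNonsplitEquiv c J hc w hw g :
          unitaryGroupOfForm (galAdicCompletionMap (L := E) c hw) (placeForm J w.1)) :
        GL (Fin N) (w.1.adicCompletion E)) ∈ glInt N (w.1.adicCompletion E) := by
  haveI : Subsingleton (PlacesOver E v) := PlacesOver.subsingleton_of_smul_eq c hc w hw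
  have hcoe : ((localNonsplitEquiv c J hc w hw g :
      unitaryGroupOfForm (galAdicCompletionMap (L := E) c hw) (placeForm J w.1)) : GL (Fin N) (w.1.adicCompletion E)) =
      localGLPiEquiv E N v (g : GL (Fin N) (LocalRing E v)) w := rfl
  rw [mem_localIntegralLevel_iff, hcoe]
  refine ⟨fun h => h w, fun h w' => ?_⟩
  obtain rfl : w = w' := Subsingleton.elim w w'
  exact h

/-- The local form of `Φ_N` at `w` is the tree's `(StdForm.antidiagonal N).over E_w`. [cite: Mok2014, §1 Notation p. 5] -/
theorem placeForm_antidiagOne (w : HeightOneSpectrum (𝓞 E)) :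
    placeForm (Matrix.of fun i j : Fin N => if i.val + j.val + 1 = N then (1 : E) else 0) w =
      (StdForm.antidiagonal N).over (w.adicCompletion E) := by
  rw [placeForm, antidiagOne_eq_over, StdForm.over_map]

/-- **Level matching at an unramified non-split place.** `c ≠ 1`, `J` `c`-hermitian, `w ∣ v` with `c • w = w`, `v` unramified in
`E`, `J_w ∈ GL_N(𝒪_w)`: the integral hyperbolic basis `T ∈ GL_N(𝒪_w)` with `J_w = ᵗσ_w(T) · Φ_N · T` ([Jacobowitz1962, §7
Thm. 7.1]; ★ `exists_glInt_placeForm_eq_formCongr_antidiagonal_of_isUnramifiedIn`, dyadic `v` included) gives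
`ψ = localNonsplitCongr … T : U(J)(F_v) ≃ₜ* U(Φ_N)(F_v)`, `g_w ↦ T g_w T⁻¹`, with `ψ g ∈ U(Φ_N)(𝒪_v) ↔ g ∈ U(J)(𝒪_v)` — both
levels are the hyperspecial `GL_N(𝒪_w) ∩ U`. [cite: Rogawski1990, §14.2 p. 233] -/
theorem exists_continuousMulEquiv_localIntegralLevel_iff_of_smul_eq (hc : c ≠ 1) (hJh : (J.map c)ᵀ = J)
    (w : PlacesOver E v) (hw : c • w.1 = w.1) (hv : Algebra.IsUnramifiedIn (𝓞 E) v.asIdeal)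
    (hJw : IsUnit (placeForm J w.1)) (hJi : hJw.unit ∈ glInt N (w.1.adicCompletion E)) :
    ∃ ψ : «local» E c N J v ≃ₜ*
        «local» E c N (Matrix.of fun i j : Fin N => if i.val + j.val + 1 = N then (1 : E) else 0) v,
      ∀ g, ψ g ∈ localIntegralLevel c N (Matrix.of fun i j : Fin N => if i.val + j.val + 1 = N then (1 : E) else 0) v ↔
        g ∈ localIntegralLevel c N J v := by
  obtain ⟨T, hT, hJT⟩ :=
    exists_glInt_placeForm_eq_formCongr_antidiagonal_of_isUnramifiedIn F E c hc N J hJh v w hw hv hJw hJi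
  have h : formCongr (galAdicCompletionMap (L := E) c hw) T
      (placeForm (Matrix.of fun i j : Fin N => if i.val + j.val + 1 = N then (1 : E) else 0) w.1) =
        (1 : w.1.adicCompletion E) • placeForm J w.1 := by
    rw [one_smul, placeForm_antidiagOne, ← hJT]
  refine ⟨localNonsplitCongr c hc w hw T isUnit_one h, fun g => ?_⟩
  rw [mem_localIntegralLevel_iff_of_smul_eq c N _ hc w hw, mem_localIntegralLevel_iff_of_smul_eq c N J hc w hw,
    localNonsplitEquiv_localNonsplitCongr]
  constructor
  · intro h'
    have h'' := Subgroup.mul_mem _ (Subgroup.mul_mem _ (Subgroup.inv_mem _ hT) h') hT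
    simpa only [mul_assoc, mul_inv_cancel_left, inv_mul_cancel, mul_one, inv_mul_cancel_left] using h''
  · intro h'
    exact Subgroup.mul_mem _ (Subgroup.mul_mem _ hT h') (Subgroup.inv_mem _ hT)

end Nonsplit

/-! ## §4 Split places: membership through `localSplitEquiv`; level matching -/

section Split

variable [Algebra.IsQuadraticExtension F E] {v : HeightOneSpectrum (𝓞 F)}

/-- At a split place (`c • w ≠ w`) where `J_w ∈ GL_N(𝒪_w)` (`J`, `J⁻¹` integral at `w`): `g ∈ U(J)(𝒪_v) ↔ g_w ∈ GL_N(𝒪_w)`,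
`g_w = localSplitEquiv g` (★ `localPiSplitEquiv_symm_mem_localInt_iff`: the second component `c_*((J g J⁻¹)⁻¹)ᵀ` is then
integral too). [cite: PlatonovRapinchuk1994, §5.1] -/
theorem mem_localIntegralLevel_iff_of_ne (hc : c ≠ 1) (hJh : (J.map c)ᵀ = J) (w : PlacesOver E v) (hw : c • w.1 ≠ w.1)
    (hJw : IsUnit (placeForm J w.1)) (hJi : hJw.unit ∈ glInt N (w.1.adicCompletion E)) (g : «local» E c N J v) :
    g ∈ localIntegralLevel c N J v ↔ localSplitEquiv c J hc hJh w hw hJw g ∈ glInt N (w.1.adicCompletion E) := by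
  rw [← localPiEquiv_symm_mem_localInt_iff]
  have h := localPiSplitEquiv_symm_mem_localInt_iff c J hc hJh w hw hJw hJi (localSplitEquiv c J hc hJh w hw hJw g)
  rwa [show localSplitEquiv c J hc hJh w hw hJw g =
      localPiSplitEquiv c J hc hJh w hw hJw ((localPiEquiv E c N J v).symm g) from rfl,
    ContinuousMulEquiv.symm_apply_apply] at h

omit [NumberField F] [NumberField E] [Algebra.IsQuadraticExtension F E] in
/-- `Φ_N` is `c`-hermitian (entries `0`, `1`, symmetric). [cite: Mok2014, §1 Notation p. 5] -/
theorem antidiagOne_map_transpose :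
    ((Matrix.of fun i j : Fin N => if i.val + j.val + 1 = N then (1 : E) else 0).map c)ᵀ =
      Matrix.of fun i j : Fin N => if i.val + j.val + 1 = N then (1 : E) else 0 := by
  rw [antidiagOne_eq_over]
  exact (congrArg Matrix.transpose (StdForm.over_map (StdForm.antidiagonal N) (c : E →+* E))).trans
    (StdForm.transpose_over _ _)

omit [NumberField F] [Algebra F E] in
/-- `Φ_N` is invertible at every place. [cite: Mok2014, §1 Notation p. 5] -/
theorem isUnit_placeForm_antidiagOne (w : HeightOneSpectrum (𝓞 E)) :
    IsUnit (placeForm (Matrix.of fun i j : Fin N => if i.val + j.val + 1 = N then (1 : E) else 0) w) := by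
  rw [placeForm_antidiagOne]
  exact StdForm.isUnit_over _ _

omit [NumberField F] [Algebra F E] in
/-- **`Φ_N` is hyperspecial at every place**: `(Φ_N)_w ∈ GL_N(𝒪_w)` (entries `0`, `1`; `Φ_N⁻¹ = Φ_N`; ★ `StdForm.unit_over_mem_glInt`).
[cite: Tits1979, §3.8] -/
theorem unit_placeForm_antidiagOne_mem_glInt (w : HeightOneSpectrum (𝓞 E)) :
    (isUnit_placeForm_antidiagOne (E := E) N w).unit ∈ glInt N (w.adicCompletion E) := by
  have h : (isUnit_placeForm_antidiagOne (E := E) N w).unit =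
      ((StdForm.antidiagonal N).isUnit_over (w.adicCompletion E)).unit :=
    Units.ext (by rw [IsUnit.unit_spec, IsUnit.unit_spec, placeForm_antidiagOne])
  rw [h]
  exact StdForm.unit_over_mem_glInt _

/-- **Level matching at a split place.** `c ≠ 1`, `J` `c`-hermitian, `w ∣ v` with `c • w ≠ w`, `J_w ∈ GL_N(𝒪_w)`:
`ψ = localSplitCongr : U(J)(F_v) ≃ₜ* GL_N(E_w) ≃ₜ* U(Φ_N)(F_v)` satisfies `ψ g ∈ U(Φ_N)(𝒪_v) ↔ g ∈ U(J)(𝒪_v)` — both levels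
are `GL_N(𝒪_w)` read in the `w`-component ([Rogawski1990, §14.2 (iii)]: at split `v`, `G′_v ≅ D_w^* = GL_N(E_w) ≅ G_v`).
[cite: Rogawski1990, §14.2 p. 233] -/
theorem exists_continuousMulEquiv_localIntegralLevel_iff_of_ne (hc : c ≠ 1) (hJh : (J.map c)ᵀ = J) (w : PlacesOver E v)
    (hw : c • w.1 ≠ w.1) (hJw : IsUnit (placeForm J w.1)) (hJi : hJw.unit ∈ glInt N (w.1.adicCompletion E)) :
    ∃ ψ : «local» E c N J v ≃ₜ*
        «local» E c N (Matrix.of fun i j : Fin N => if i.val + j.val + 1 = N then (1 : E) else 0) v,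
      ∀ g, ψ g ∈ localIntegralLevel c N (Matrix.of fun i j : Fin N => if i.val + j.val + 1 = N then (1 : E) else 0) v ↔
        g ∈ localIntegralLevel c N J v := by
  refine ⟨localSplitCongr c hc hJh (antidiagOne_map_transpose c N) w hw hJw (isUnit_placeForm_antidiagOne N w.1),
    fun g => ?_⟩
  rw [mem_localIntegralLevel_iff_of_ne c N _ hc (antidiagOne_map_transpose c N) w hw (isUnit_placeForm_antidiagOne N w.1)
      (unit_placeForm_antidiagOne_mem_glInt N w.1),
    mem_localIntegralLevel_iff_of_ne c N J hc hJh w hw hJw hJi, localSplitEquiv_localSplitCongr]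

end Split

/-! ## §5 Level matching at almost every place -/

section AE

variable [Algebra.IsQuadraticExtension F E]

/-- **The local isomorphisms `ψ_v : U(J)(F_v) ≃ₜ* U(Φ_N)(F_v)` can be chosen LEVEL-PRESERVING at almost every `v`** —
[Rogawski1990, §14.2 p. 233]: «for `v ∉ S₀ ∪ S` … `K_v ≃ K′_v`».  For `c ≠ 1` and a `c`-hermitian `J ∈ M_N(E)` with `det J` a
unit: `∀ᶠ v, ∃ ψ, ∀ g, ψ g ∈ U(Φ_N)(𝒪_v) ↔ g ∈ U(J)(𝒪_v)`; the exceptional places are those ramified in `E` and those with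
`J_w ∉ GL_N(𝒪_w)` (§2), elsewhere §3 (non-split) ∕ §4 (split). [cite: Rogawski1990, §14.2 p. 233] -/
theorem eventually_exists_continuousMulEquiv_localIntegralLevel_iff (hc : c ≠ 1) (hJh : (J.map c)ᵀ = J)
    (hJ : IsUnit J.det) :
    ∀ᶠ v : HeightOneSpectrum (𝓞 F) in cofinite,
      ∃ ψ : «local» E c N J v ≃ₜ*
          «local» E c N (Matrix.of fun i j : Fin N => if i.val + j.val + 1 = N then (1 : E) else 0) v,
        ∀ g, ψ g ∈ localIntegralLevel c N (Matrix.of fun i j : Fin N => if i.val + j.val + 1 = N then (1 : E) else 0) v ↔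
          g ∈ localIntegralLevel c N J v := by
  have hJu : IsUnit J := (Matrix.isUnit_iff_isUnit_det J).2 hJ
  filter_upwards [eventually_forall_unit_placeForm_mem_glInt (F := F) N J hJu,
    (finite_setOf_not_isUnramifiedIn (F := F) (E := E)).compl_mem_cofinite] with v hint hunr
  have hv : Algebra.IsUnramifiedIn (𝓞 E) v.asIdeal := not_not.1 hunr
  obtain ⟨w⟩ := (inferInstance : Nonempty (PlacesOver E v))
  by_cases hw : c • w.1 = w.1
  · exact exists_continuousMulEquiv_localIntegralLevel_iff_of_smul_eq c N J hc hJh w hw hv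
      (isUnit_placeForm J hJu w.1) (hint w)
  · exact exists_continuousMulEquiv_localIntegralLevel_iff_of_ne c N J hc hJh w hw (isUnit_placeForm J hJu w.1) (hint w)

/-- The same in `Subgroup.comap` form: `ψ⁻¹(U(Φ_N)(𝒪_v)) = U(J)(𝒪_v)` at almost every `v`. [cite: Rogawski1990, §14.2 p. 233] -/
theorem eventually_exists_continuousMulEquiv_comap_localIntegralLevel_eq (hc : c ≠ 1) (hJh : (J.map c)ᵀ = J)
    (hJ : IsUnit J.det) :
    ∀ᶠ v : HeightOneSpectrum (𝓞 F) in cofinite,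
      ∃ ψ : «local» E c N J v ≃ₜ*
          «local» E c N (Matrix.of fun i j : Fin N => if i.val + j.val + 1 = N then (1 : E) else 0) v,
        (localIntegralLevel c N (Matrix.of fun i j : Fin N => if i.val + j.val + 1 = N then (1 : E) else 0) v).comap
            ψ.toMulEquiv.toMonoidHom = localIntegralLevel c N J v := by
  filter_upwards [eventually_exists_continuousMulEquiv_localIntegralLevel_iff c N J hc hJh hJ] with v hv
  obtain ⟨ψ, hψ⟩ := hv
  exact ⟨ψ, Subgroup.ext fun g => hψ g⟩

end AE

end Generic

/-! ## §6 The CM dress: carriers `(cmDatum L N H).Local v` -/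

section CM

variable (L : Type) [Field L] [NumberField L] [IsCMField L] (N : ℕ) (H : Matrix (Fin N) (Fin N) L)

/-- **`U(H)(𝒪_v) ≤ (cmDatum L N H).Local v`** for a CM field `L` (`F = L⁺`, `c` = complex conjugation): the local integral level
of §1 on the carrier of the tree's adelic datum (`cmDatum_Local` is `rfl`). [cite: PlatonovRapinchuk1994, §5.1] -/
abbrev cmLocalIntegralLevel (v : HeightOneSpectrum (𝓞 ↥(maximalRealSubfield L))) : Subgroup ((cmDatum L N H).Local v) :=
  localIntegralLevel (IsCMField.complexConj L) N H v

/-- `U(H)(𝒪_v)` is compact and open in `(cmDatum L N H).Local v`. [cite: PlatonovRapinchuk1994, §5.1] -/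
theorem isCompact_isOpen_cmLocalIntegralLevel (v : HeightOneSpectrum (𝓞 ↥(maximalRealSubfield L))) :
    IsCompact (cmLocalIntegralLevel L N H v : Set ((cmDatum L N H).Local v)) ∧
      IsOpen (cmLocalIntegralLevel L N H v : Set ((cmDatum L N H).Local v)) :=
  ⟨isCompact_localIntegralLevel (IsCMField.complexConj L) N H v, isOpen_localIntegralLevel (IsCMField.complexConj L) N H v⟩

/-- **CM a.e. level matching** for a hermitian `H` (`ᵗH̄ = H`) with `det H` a unit: for almost every finite place `v` of `L⁺`
there is `ψ_v : (cmDatum L N H).Local v ≃ₜ* (cmDatum L N Φ_N).Local v` with `ψ_v g ∈ U(Φ_N)(𝒪_v) ↔ g ∈ U(H)(𝒪_v)`.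
[cite: Rogawski1990, §14.2 p. 233] -/
theorem eventually_exists_continuousMulEquiv_cmLocalIntegralLevel_iff (hH : (H.map (cmConjRingHom L))ᵀ = H)
    (hHd : IsUnit H.det) :
    ∀ᶠ v : HeightOneSpectrum (𝓞 ↥(maximalRealSubfield L)) in cofinite,
      ∃ ψ : (cmDatum L N H).Local v ≃ₜ*
          (cmDatum L N (Matrix.of fun i j : Fin N => if i.val + j.val + 1 = N then (1 : L) else 0)).Local v,
        ∀ g, ψ g ∈ cmLocalIntegralLevel L N (Matrix.of fun i j : Fin N => if i.val + j.val + 1 = N then (1 : L) else 0) v ↔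
          g ∈ cmLocalIntegralLevel L N H v :=
  eventually_exists_continuousMulEquiv_localIntegralLevel_iff (IsCMField.complexConj L) N H (IsCMField.complexConj_ne_one L)
    hH hHd

/-- The same for an ANISOTROPIC hermitian `H` (the binders of the quasi-split comparison of the line
`F0_T1InnerFormTraceIdentity`; anisotropic ⇒ `det H ≠ 0`, ★ `Godement.det_ne_zero_of_anisotropic`). [cite: Rogawski1990, §14.2 p. 233] -/
theorem eventually_exists_continuousMulEquiv_cmLocalIntegralLevel_iff_of_anisotropic
    (hanis : ∀ x : Fin N → L, Literature.AlgebraicGeometry.ShimuraVarieties.hermForm (cmConjRingHom L) H x x = 0 → x = 0)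
    (hH : (H.map (cmConjRingHom L))ᵀ = H) :
    ∀ᶠ v : HeightOneSpectrum (𝓞 ↥(maximalRealSubfield L)) in cofinite,
      ∃ ψ : (cmDatum L N H).Local v ≃ₜ*
          (cmDatum L N (Matrix.of fun i j : Fin N => if i.val + j.val + 1 = N then (1 : L) else 0)).Local v,
        ∀ g, ψ g ∈ cmLocalIntegralLevel L N (Matrix.of fun i j : Fin N => if i.val + j.val + 1 = N then (1 : L) else 0) v ↔
          g ∈ cmLocalIntegralLevel L N H v :=
  eventually_exists_continuousMulEquiv_cmLocalIntegralLevel_iff L N H hH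
    (isUnit_iff_ne_zero.2 (Godement.det_ne_zero_of_anisotropic L H hanis))

end CM

end Literature.NumberTheory.Automorphic.UnitaryGroup

end
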